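import Summits.AtomisticToContinuum.BoseEinsteinCondensation.Theorems.BlockLatticeFSumMixedFloorTail

/-!
# MF «BoxMixedFloor» PROVED (lens-6 g29's BoxLatticeFSum carving of the BEC conjunct; decomp-a2c hand-2 g8)

`BoxLatticeFSum.BoxMixedFloor` (TAG WEAKER · TRUE-type · ATTACKABLE-NOW in critic row 412 (3)): for every repulsive finite-range `v`, block
constant `A > 0` and loss `η > 0`, below a density cap, eventually in `N`, every Dirichlet `δ`-near-minimiser of the box of side
`L = (N/ρ)^{1/3}` has discounted mixed floor `∑_m n(pieceMode L K s m) ≥ (1−η)N` for every even `K > 0` with `L/K ∈ [A, 2A]/√ρ` and every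
shift class `s ∈ {0,1}³`.  Proof = the tree's F♭ (`cellNBudgetBlockFloor_holds`, 13595 chain) transported to translated, zero-extended
Dirichlet states (`dirichletBudgetBlockFloor_shift`, two instances with block constants `2A`, `A`), the tail `mixedFloor_tail`, and the
energy budget: Dyson's upper bound `E₀ ≤ 4πaρN(1 + C(ρa³)^{1/3})` (`eventually_groundStateEnergy_le_dyson`) when `a > 0`, the free
bound `E₀ = E₀(v ≡ 0) ≤ N·𝓔₀[β]/L²` (`groundStateEnergy_eq_zero`, `groundStateEnergy_zero_le`) when `a = 0`; slack `δ = τρN/4`.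
* `boxMixedFloor : BoxMixedFloor` (BY NAME).  `[folklore]` / [LSSY2005, Thm 5.1]; no definitions, no `sorry`.
-/

noncomputable section

open MeasureTheory Set Filter
open scoped ENNReal NNReal BigOperators

namespace Summit.AtomisticToContinuum.BoseEinsteinCondensation.Theorems.BlockLatticeFSumMixedFloor

open Literature.MathematicalPhysics.QuantumManyBody.BoseGas
open Summit.AtomisticToContinuum.BoseEinsteinCondensation.Theorems.BoxLatticeFSum (BoxMixedFloor InWindow pieceMode blockShift)
open Summit.AtomisticToContinuum.BoseEinsteinCondensation.Theorems.BlockLatticeFSumDirichletFloorShift (dirichletBudgetBlockFloor_shift)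
open Summit.AtomisticToContinuum.BoseEinsteinCondensation.Theorems.BlockLatticeFSumMixedFloorTail (mixedFloor_tail)

set_option maxHeartbeats 1600000 in
/-- **MF holds.** [cite: LSSY2005, Thm. 5.1 (5.15)–(5.17), Lemma 5.2; folklore (carrier transport)] -/
theorem boxMixedFloor : BoxMixedFloor := by
  intro v hv A hA η hη
  have hvm : Measurable v := hv.1
  obtain ⟨R₀, hR₀⟩ := hv.2
  have hfin : scatteringLength v ≠ ⊤ := scatteringLength_ne_top_of_finiteRange hR₀
  obtain ⟨ρ₁, hρ₁, τ₁, hτ₁, N₁, H₁⟩ := dirichletBudgetBlockFloor_shift v hv (2 * A) (by positivity) η hη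
  obtain ⟨ρ₂, hρ₂, τ₂, hτ₂, N₂, H₂⟩ := dirichletBudgetBlockFloor_shift v hv A hA η hη
  obtain ⟨τ, hτdef⟩ : ∃ τ : ℝ, τ = min τ₁ τ₂ := ⟨_, rfl⟩
  have hτ : 0 < τ := by rw [hτdef]; exact lt_min hτ₁ hτ₂
  have hτ1 : τ ≤ τ₁ := by rw [hτdef]; exact min_le_left _ _
  have hτ2 : τ ≤ τ₂ := by rw [hτdef]; exact min_le_right _ _
  obtain ⟨a, hadef⟩ : ∃ a : ℝ, a = (scatteringLength v).toReal := ⟨_, rfl⟩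
  have ha0 : 0 ≤ a := by rw [hadef]; exact ENNReal.toReal_nonneg
  -- `K₀`: `(4πa + τ)·12 ≤ (τ/4)·K₀`, `K₀ ≥ 48`
  obtain ⟨K₀, hK₀48, hK₀⟩ : ∃ K₀ : ℕ, 48 ≤ K₀ ∧ (4 * Real.pi * a + τ) * 12 ≤ τ / 4 * (K₀ : ℝ) := by
    obtain ⟨n, hn⟩ := exists_nat_ge ((4 * Real.pi * a + τ) * 12 / (τ / 4))
    refine ⟨max 48 n, le_max_left _ _, ?_⟩
    have hn' : (4 * Real.pi * a + τ) * 12 ≤ τ / 4 * (n : ℝ) := by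
      rw [div_le_iff₀ (by positivity)] at hn; linarith
    have hmax : (n : ℝ) ≤ ((max 48 n : ℕ) : ℝ) := by exact_mod_cast le_max_right _ _
    have := mul_le_mul_of_nonneg_left hmax (by positivity : (0 : ℝ) ≤ τ / 4)
    linarith
  obtain ⟨c₁, hc₁⟩ : ∃ c₁ : ℝ, c₁ = 1 - 12 / (K₀ : ℝ) := ⟨_, rfl⟩
  have hK₀r : (48 : ℝ) ≤ K₀ := by exact_mod_cast hK₀48
  have hc₁34 : 3 / 4 ≤ c₁ := by
    rw [hc₁]
    have : 12 / (K₀ : ℝ) ≤ 1 / 4 := by rw [div_le_div_iff₀ (by linarith) (by norm_num)]; linarith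
    linarith
  have hcoefK : (4 * Real.pi * a + τ) * (12 / (K₀ : ℝ)) ≤ τ / 4 := by
    rw [show (4 * Real.pi * a + τ) * (12 / (K₀ : ℝ)) = (4 * Real.pi * a + τ) * 12 / K₀ by ring,
      div_le_iff₀ (by linarith)]
    exact hK₀
  -- `K ≥ K₀` from the window once `L ≥ 2AK₀/√ρ`
  have hKlarge : ∀ {ρ : ℝ} (hρ : 0 < ρ) {N K : ℕ}, 0 < K → 2 * A * (K₀ : ℝ) / Real.sqrt ρ ≤ sideLength ρ N →
      InWindow A ρ (sideLength ρ N) K → K₀ ≤ K := by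
    intro ρ hρ N K hKpos hLK hwin
    have hKr : (0 : ℝ) < K := by exact_mod_cast hKpos
    have hs : 0 < 2 * A / Real.sqrt ρ := by have := Real.sqrt_pos.2 hρ; positivity
    have h1 : sideLength ρ N ≤ (K : ℝ) * (2 * A / Real.sqrt ρ) := by
      have hw2 := hwin.2; rw [div_le_iff₀ hKr] at hw2; linarith
    have h2 : (K₀ : ℝ) * (2 * A / Real.sqrt ρ) ≤ sideLength ρ N := by
      rw [show (K₀ : ℝ) * (2 * A / Real.sqrt ρ) = 2 * A * (K₀ : ℝ) / Real.sqrt ρ by ring]; exact hLK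
    have : (K₀ : ℝ) ≤ K := le_of_mul_le_mul_right (h2.trans h1) hs
    exact_mod_cast this
  by_cases hapos : 0 < scatteringLength v
  · ----------------------------------------------------------------
    -- `a > 0`: Dyson's upper bound pays the budget
    ----------------------------------------------------------------
    have ha : 0 < a := by rw [hadef]; exact ENNReal.toReal_pos hapos.ne' hfin
    obtain ⟨C, ρu, hC, hρu, Hup⟩ := eventually_groundStateEnergy_le_dyson hR₀ hvm hfin hapos
    -- `ρY`: `4πaC (ρa³)^{1/3} ≤ τ/4` for `ρ ≤ ρY`
    obtain ⟨t, htdef⟩ : ∃ t : ℝ, t = τ / (4 * (4 * Real.pi * a * C)) := ⟨_, rfl⟩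
    have ht : 0 < t := by rw [htdef]; positivity
    obtain ⟨ρY, hρYdef⟩ : ∃ ρY : ℝ, ρY = t ^ 3 / a ^ 3 := ⟨_, rfl⟩
    have hρY : 0 < ρY := by rw [hρYdef]; positivity
    refine ⟨min (min ρ₁ ρ₂) (min ρu ρY), by positivity, fun ρ hρ hρlt => ?_⟩
    have hρ1 : ρ ≤ ρ₁ := hρlt.le.trans ((min_le_left _ _).trans (min_le_left _ _))
    have hρ2 : ρ ≤ ρ₂ := hρlt.le.trans ((min_le_left _ _).trans (min_le_right _ _))
    have hρu' : ρ < ρu := lt_of_lt_of_le hρlt ((min_le_right _ _).trans (min_le_left _ _))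
    have hρY' : ρ ≤ ρY := hρlt.le.trans ((min_le_right _ _).trans (min_le_right _ _))
    have hYb : 4 * Real.pi * a * C * (ρ * a ^ 3) ^ ((1 : ℝ) / 3) ≤ τ / 4 := by
      have h1 : ρ * a ^ 3 ≤ t ^ 3 := by
        have : ρ * a ^ 3 ≤ ρY * a ^ 3 := mul_le_mul_of_nonneg_right hρY' (by positivity)
        rw [hρYdef, div_mul_cancel₀ _ (by positivity)] at this
        exact this
      have h2 : (ρ * a ^ 3) ^ ((1 : ℝ) / 3) ≤ t := by
        calc (ρ * a ^ 3) ^ ((1 : ℝ) / 3) ≤ (t ^ 3) ^ ((1 : ℝ) / 3) :=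
              Real.rpow_le_rpow (by positivity) h1 (by norm_num)
          _ = t := by rw [← Real.rpow_natCast, ← Real.rpow_mul ht.le]; norm_num
      calc 4 * Real.pi * a * C * (ρ * a ^ 3) ^ ((1 : ℝ) / 3) ≤ 4 * Real.pi * a * C * t :=
            mul_le_mul_of_nonneg_left h2 (by positivity)
        _ = τ / 4 := by rw [htdef]; field_simp
    filter_upwards [Hup ρ hρ hρu', eventually_ge_atTop (max N₁ N₂), eventually_ge_atTop 1,
      (tendsto_sideLength_atTop hρ).eventually_ge_atTop (2 * A * (K₀ : ℝ) / Real.sqrt ρ)] with N hD hN12 hN1 hLK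
    have hNpos : 0 < N := hN1
    have hNr : (0 : ℝ) < N := by exact_mod_cast hNpos
    refine ⟨ENNReal.ofReal (τ / 4 * ρ * N), ENNReal.ofReal_pos.2 (by positivity), fun Ψ hE K hKev hKpos hwin s => ?_⟩
    have hKK₀ : K₀ ≤ K := hKlarge hρ hKpos hLK hwin
    have hbud : ∀ L' : ℝ, 0 < L' → c₁ * ρ ≤ (N : ℝ) / L' ^ 3 → (N : ℝ) / L' ^ 3 ≤ ρ →
        energy v Ψ ≤ ENNReal.ofReal ((4 * Real.pi * (scatteringLength v).toReal + τ) * ((N : ℝ) / L' ^ 3) * N) := by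
      intro L' hL' hlo hhi
      rw [← hadef] at hD ⊢
      have hcoef : 4 * Real.pi * ρ * a * (1 + C * (ρ * a ^ 3) ^ ((1 : ℝ) / 3)) + τ / 4 * ρ ≤
          (4 * Real.pi * a + τ) * ((N : ℝ) / L' ^ 3) := by
        have h1 : (4 * Real.pi * a + τ) * (c₁ * ρ) ≤ (4 * Real.pi * a + τ) * ((N : ℝ) / L' ^ 3) :=
          mul_le_mul_of_nonneg_left hlo (by positivity)
        have h2 : (4 * Real.pi * a + τ) * (c₁ * ρ) = (4 * Real.pi * a + τ) * ρ - (4 * Real.pi * a + τ) * (12 / (K₀ : ℝ)) * ρ := by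
          rw [hc₁]; ring
        have h3 : (4 * Real.pi * a + τ) * (12 / (K₀ : ℝ)) * ρ ≤ τ / 4 * ρ := mul_le_mul_of_nonneg_right hcoefK hρ.le
        have h4 : 4 * Real.pi * ρ * a * (1 + C * (ρ * a ^ 3) ^ ((1 : ℝ) / 3)) =
            4 * Real.pi * a * ρ + ρ * (4 * Real.pi * a * C * (ρ * a ^ 3) ^ ((1 : ℝ) / 3)) := by ring
        have h5 : ρ * (4 * Real.pi * a * C * (ρ * a ^ 3) ^ ((1 : ℝ) / 3)) ≤ ρ * (τ / 4) := mul_le_mul_of_nonneg_left hYb hρ.le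
        have h6 : 0 ≤ τ * ρ := by positivity
        calc 4 * Real.pi * ρ * a * (1 + C * (ρ * a ^ 3) ^ ((1 : ℝ) / 3)) + τ / 4 * ρ
            = 4 * Real.pi * a * ρ + ρ * (4 * Real.pi * a * C * (ρ * a ^ 3) ^ ((1 : ℝ) / 3)) + τ / 4 * ρ := by ring
          _ ≤ 4 * Real.pi * a * ρ + ρ * (τ / 4) + τ / 4 * ρ := by linarith [h5]
          _ = (4 * Real.pi * a + τ) * ρ - τ / 2 * ρ := by ring
          _ ≤ (4 * Real.pi * a + τ) * ρ - (4 * Real.pi * a + τ) * (12 / (K₀ : ℝ)) * ρ := by linarith [h3, h6]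
          _ = (4 * Real.pi * a + τ) * (c₁ * ρ) := h2.symm
          _ ≤ (4 * Real.pi * a + τ) * ((N : ℝ) / L' ^ 3) := h1
      calc energy v Ψ ≤ groundStateEnergy v N (sideLength ρ N) + ENNReal.ofReal (τ / 4 * ρ * N) := hE
        _ ≤ ENNReal.ofReal (4 * Real.pi * ρ * a * (1 + C * (ρ * a ^ 3) ^ ((1 : ℝ) / 3)) * N) +
              ENNReal.ofReal (τ / 4 * ρ * N) := add_le_add hD le_rfl
        _ = ENNReal.ofReal (4 * Real.pi * ρ * a * (1 + C * (ρ * a ^ 3) ^ ((1 : ℝ) / 3)) * N + τ / 4 * ρ * N) :=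
              (ENNReal.ofReal_add (by positivity) (by positivity)).symm
        _ ≤ ENNReal.ofReal ((4 * Real.pi * a + τ) * ((N : ℝ) / L' ^ 3) * N) := by
              refine ENNReal.ofReal_le_ofReal ?_
              have := mul_le_mul_of_nonneg_right hcoef hNr.le
              linarith
    exact mixedFloor_tail hA H₁ H₂ hτ1 hτ2 hρ hρ1 hρ2 ((le_max_left _ _).trans hN12) ((le_max_right _ _).trans hN12) hNpos Ψ
      hbud hKev hK₀48 hKK₀ hc₁ hwin s
  · ----------------------------------------------------------------
    -- `a = 0`: the free bound pays the budget
    ----------------------------------------------------------------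
    have hsl0 : scatteringLength v = 0 := le_antisymm (not_lt.1 hapos) bot_le
    have haz : (scatteringLength v).toReal = 0 := by rw [hsl0]; rfl
    obtain ⟨E₁, hE₁def⟩ : ∃ E₁ : ℝ, E₁ = (energy 0 unitBump).toReal := ⟨_, rfl⟩
    have hE₁0 : 0 ≤ E₁ := by rw [hE₁def]; exact ENNReal.toReal_nonneg
    have hEeq : energy 0 unitBump = ENNReal.ofReal E₁ := by rw [hE₁def]; exact energy_unitBump_eq_ofReal
    refine ⟨min ρ₁ ρ₂, lt_min hρ₁ hρ₂, fun ρ hρ hρlt => ?_⟩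
    have hρ1 : ρ ≤ ρ₁ := hρlt.le.trans (min_le_left _ _)
    have hρ2 : ρ ≤ ρ₂ := hρlt.le.trans (min_le_right _ _)
    filter_upwards [eventually_ge_atTop (max N₁ N₂), eventually_ge_atTop 1,
      (tendsto_sideLength_atTop hρ).eventually_ge_atTop (2 * A * (K₀ : ℝ) / Real.sqrt ρ),
      (tendsto_sideLength_atTop hρ).eventually_ge_atTop (Real.sqrt (2 * E₁ / (τ * ρ)))] with N hN12 hN1 hLK hLE
    have hNpos : 0 < N := hN1
    have hNr : (0 : ℝ) < N := by exact_mod_cast hNpos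
    have hL : 0 < sideLength ρ N := sideLength_pos_of_pos hρ hNpos
    refine ⟨ENNReal.ofReal (τ / 4 * ρ * N), ENNReal.ofReal_pos.2 (by positivity), fun Ψ hE K hKev hKpos hwin s => ?_⟩
    have hKK₀ : K₀ ≤ K := hKlarge hρ hKpos hLK hwin
    -- the free bound on the budget
    have hfree : groundStateEnergy v N (sideLength ρ N) ≤ ENNReal.ofReal ((N : ℝ) * E₁ / sideLength ρ N ^ 2) := by
      rw [GapWindowLadderFreeWindowModes.groundStateEnergy_eq_zero hv hsl0]
      refine (groundStateEnergy_zero_le hL N).trans (le_of_eq ?_)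
      have h2 : ((N : ℕ) : ℝ≥0∞) * energy 0 unitBump = ENNReal.ofReal ((N : ℝ) * E₁) := by
        rw [hEeq, ← ENNReal.ofReal_natCast, ← ENNReal.ofReal_mul (by positivity)]
      rw [h2, ← ENNReal.ofReal_mul (by positivity)]
      congr 1
      field_simp
    have hEL : E₁ / sideLength ρ N ^ 2 ≤ τ * ρ / 2 := by
      have h1 : Real.sqrt (2 * E₁ / (τ * ρ)) ^ 2 ≤ sideLength ρ N ^ 2 := pow_le_pow_left₀ (Real.sqrt_nonneg _) hLE 2
      rw [Real.sq_sqrt (by positivity)] at h1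
      rw [div_le_iff₀ (by positivity)]
      rw [div_le_iff₀ (by positivity)] at h1
      linarith
    have hbud : ∀ L' : ℝ, 0 < L' → c₁ * ρ ≤ (N : ℝ) / L' ^ 3 → (N : ℝ) / L' ^ 3 ≤ ρ →
        energy v Ψ ≤ ENNReal.ofReal ((4 * Real.pi * (scatteringLength v).toReal + τ) * ((N : ℝ) / L' ^ 3) * N) := by
      intro L' hL' hlo hhi
      rw [haz]
      have hcoef : (N : ℝ) * E₁ / sideLength ρ N ^ 2 + τ / 4 * ρ * N ≤ (4 * Real.pi * 0 + τ) * ((N : ℝ) / L' ^ 3) * N := by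
        have h1 : (N : ℝ) * E₁ / sideLength ρ N ^ 2 = N * (E₁ / sideLength ρ N ^ 2) := by ring
        have h2 : (N : ℝ) * (E₁ / sideLength ρ N ^ 2) ≤ N * (τ * ρ / 2) := mul_le_mul_of_nonneg_left hEL hNr.le
        have h3 : τ * (c₁ * ρ) * N ≤ τ * ((N : ℝ) / L' ^ 3) * N :=
          mul_le_mul_of_nonneg_right (mul_le_mul_of_nonneg_left hlo hτ.le) hNr.le
        have h4 : τ * (3 / 4 * ρ) * N ≤ τ * (c₁ * ρ) * N :=
          mul_le_mul_of_nonneg_right (mul_le_mul_of_nonneg_left (mul_le_mul_of_nonneg_right hc₁34 hρ.le) hτ.le) hNr.le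
        nlinarith
      calc energy v Ψ ≤ groundStateEnergy v N (sideLength ρ N) + ENNReal.ofReal (τ / 4 * ρ * N) := hE
        _ ≤ ENNReal.ofReal ((N : ℝ) * E₁ / sideLength ρ N ^ 2) + ENNReal.ofReal (τ / 4 * ρ * N) := add_le_add hfree le_rfl
        _ = ENNReal.ofReal ((N : ℝ) * E₁ / sideLength ρ N ^ 2 + τ / 4 * ρ * N) :=
              (ENNReal.ofReal_add (by positivity) (by positivity)).symm
        _ ≤ _ := ENNReal.ofReal_le_ofReal hcoef
    exact mixedFloor_tail hA H₁ H₂ hτ1 hτ2 hρ hρ1 hρ2 ((le_max_left _ _).trans hN12) ((le_max_right _ _).trans hN12) hNpos Ψ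
      hbud hKev hK₀48 hKK₀ hc₁ hwin s

end Summit.AtomisticToContinuum.BoseEinsteinCondensation.Theorems.BlockLatticeFSumMixedFloor

end
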